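import Summits.ABC.IUTFork.Cor312PilotIdelesMRead
import Literature.IUT.LogVolume.GenuineLogThetaExactVolume
import Literature.IUT.LogVolume.GenuineLogThetaIdeleInvariance
import HarnessLib

/-!
# [IUTchIII] Corollary 3.12 — the GENUINE-SIDE IDENTIFICATION for G1-Θ: the orbit-hull log-volumes of the M-LEVEL
# presentation ARE the summands of abc-iut-S2's `−|log(Θ)|` (unit P6-ident of `HOME/staging/w5/w5-d166/g4/G1-THETA-SHAPES.md`)

PROOF-ONLY record file with two auxiliary data definitions (D-0012) of the abc-iut cell (seat abc-iut-w5-d166, gen 4;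
branch C «abc ⇐ S», C-lead ruling C-R12 (e) «target #2′: the M-level (V̲, K_{v̲}) real volume setting»). TAKES NO SIDE
on [IUTchIII] Cor. 3.12.

abc-iut-S2's GENUINE `−|log(Θ)|` of a Θ-volume input `I` (`GenuineLogTheta`: [IUTchIII] Cor. 3.12, kurims
`paper:url-4b091feeb646` p. 173 l. 43 – p. 174 l. 3, "the procession-normalized mono-analytic log-volume of the
holomorphic hull of the union of the possible images of a Θ-pilot object"; Dupuy–Hilado §4.11–4.12) is
`negLogThetaNonarch I = Σ_{p ∈ T(I)} negLogThetaLoc p`, `negLogThetaLoc p = (I.packetAt p).negLogThetaAt ℓ⋆ (I.tΘ p)`,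
the latter over the real prime packet of the GENUINE completions `K_{v̲}`, `v ∈ V(F_mod)_p` (`realPrimePacketM
((placeSection D).localFieldFamily p)` for `I = volumeInputOf D r`). The M-level presentation of unit P1
(`padicPresentationOfInitialDH`, p433804) has summands indexed by `v⃗' : S^±_{j+1} → V̲_u` with fields
`kOfM x = K_{𝔭_{w(x)}}` — the same completions up to the index identification `V̲_u ≅ V(F_mod)_p` of unit P4a
(abc-iut-w5-d033 `fibreEquivPlacesOverM`, `liftPlace_placeModOfM`, the idele read-off `tThetaM`, p436273). THIS FILE
closes the genuine side of G1-Θ: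

* §1 `localFieldsM D p u hu : LocalFields F_mod p` — the M-level carriers READ AS abc-iut-c312-3's local-field family
  over `V(F_mod)_p` (`k v := kOfM (fibreOfPlaceOverM v)`), so that P1's summand at `v⃗' = fibreOfPlaceOverM ∘ v⃗` IS
  c312-3's `realPrimePacketM (localFieldsM …)` summand at `v⃗`, DEFINITIONALLY; `ofPlaces w hw` (a family of rescaled
  completions of `K` indexed by a place map) with `localFields_eq_ofPlaces` / `localFieldsM_eq_ofPlaces` (`rfl`); the
  Θ-ideles as units `tUnitsM r`;
* §2 TRANSPORT: `negLogThetaAt_ofPlaces_eq` — abc-iut-c312-3's `negLogThetaAt` over `realPrimePacketM (ofPlaces w hw)`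
  depends only on the place map `w` and the NORMS of the ideles (abc-iut-w5-d156 `realPrimePacketWith_negLogThetaAt_eq_of_norm_eq`),
  hence **`negLogThetaAt_localFieldsM_eq`**: `−|log(Θ)|_p` computed on the M-level carriers with P4a's ideles EQUALS S2's
  `(realPrimePacketM ((placeSection D).localFields p)).negLogThetaAt ℓ⋆ (r.tΘ p)` (place maps agree by
  `liftPlace_placeModOfM`, norms by `norm_castOfEq`) `= (volumeInputOf D r).negLogThetaLoc p`;
* §3 REINDEXING: **`sum_fibre_weightM_orbitHull_eq_lnνTensorPower`** — the Pr-weighted sum over `v⃗' : S^±_{i+2} → V̲_u` of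
  the normalised log-measures of the `(R_I)^∼`-hulls of the (Ind2)-orbits of the slot unions `⋃_a ι_a(t_{Θ,i,v̲'_a})·(R_I)^∼`
  (the shape of the setting-side hull bound, SHAPES (U1); abc-iut-s2-p7's `thetaLocal_untopD_le_sum_logμ_packetHull_orbit`)
  IS c312-3's `lnνTensorPower (i+1)` of the hull of the possible images of the pilot region over `localFieldsM`
  (`realPrimePacketWith_possibleImages_pilotRegion_eq`), and **`procAvg_sum_fibre_weightM_orbitHull_eq_negLogThetaLoc`**:
  its procession average over `i` IS `(volumeInputOf D r).negLogThetaLoc p` — the `p`-summand of S2's `negLogThetaNonarch`.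

So, with unit (R) (`Cor312ThetaSideReduction`, p432344) and the setting-side hull bound at the M-level sharp setting
(units P4/P5/(U1)-HULL), `(M-setting).negLogTheta ≤ ↑(volumeInputOf D r).negLogTheta` follows place by place.
[cite: Mochizuki2012, IUTchIII Cor. 3.12 p. 173–174] [cite: Mochizuki2012, IUTchI Def. 3.1 (e) p. 62]
[cite: DupuyHilado2025, Def. 3.6.1, Def. 3.6.3, §4.11–4.12] [claim: Mochizuki2012, status: disputed] for the quoted
notions. HONEST FRAMING: an identity between OUR two typings of the same printed quantity; nothing here bears on
the truth of [IUTchIII] Cor. 3.12; typed ≠ proved; instantiated ≠ endorsed.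
-/

noncomputable section

open Set Function NumberField IsDedekindDomain
open scoped Pointwise

namespace Summit.ABC.IUTFork.Thm311.Real

open Cor312Vol Literature.IUT.LogThetaLattice Literature.IUT.LogVolume Literature.IUT.HodgeTheaters
  Literature.NumberTheory.NumberFields

/-! ## §1. Families of rescaled completions indexed by a place map; the M-level carriers as a family over `V(F_mod)_p` -/

section OfPlaces

variable {F₀ K : Type} [Field F₀] [NumberField F₀] [Field K] [NumberField K] (p : ℕ) [hp : Fact p.Prime]

/-- The local-field family `v ↦ K_{w(v)}` (abc-iut-S7's rescaled completions of `K`) over `V(F₀)_p` determined by a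
place map `w : V(F₀)_p → V(K)` with `p ∈ 𝔭_{w(v)}`. Both abc-iut-S2's `PlaceSection.localFields` (`w = σ.lift`) and the
M-level carriers of unit P1 read over `V(F_mod)_p` (`w = placeOfM ∘ fibreOfPlaceOverM`) are of this form, definitionally.
[cite: DupuyHilado2025, Def. 3.6.1] -/
def ofPlaces (w : placesOver F₀ p → HeightOneSpectrum (𝓞 K)) (hw : ∀ v, ((p : ℕ) : 𝓞 K) ∈ (w v).asIdeal) :
    LocalFields F₀ p where
  k v := RescaledCompletion K p (w v) (hw v)

/-- abc-iut-S2's genuine local fields at a section ARE `ofPlaces` at the place map `σ.lift` (definitional).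
[cite: DupuyHilado2025, Def. 3.6.1] -/
theorem localFields_eq_ofPlaces [Algebra F₀ K] (σ : PlaceSection F₀ K) :
    σ.localFields p = ofPlaces p (fun v => σ.lift v.1) (fun v => σ.natCast_mem_lift v) := rfl

/-- **TRANSPORT**: abc-iut-c312-3's `−|log(Θ)|_p` over the real prime packet of a place family depends only on the
place map and on the NORMS of the ideles — equal place maps (pointwise) and ideles of equal norms give the same number
(abc-iut-w5-d156 `realPrimePacketWith_negLogThetaAt_eq_of_norm_eq` after identifying the carriers).
[cite: DupuyHilado2025, §1 (1.1), §4.11–4.12] -/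
theorem negLogThetaAt_ofPlaces_eq {w w' : placesOver F₀ p → HeightOneSpectrum (𝓞 K)}
    (hw : ∀ v, ((p : ℕ) : 𝓞 K) ∈ (w v).asIdeal) (hw' : ∀ v, ((p : ℕ) : 𝓞 K) ∈ (w' v).asIdeal)
    (h : ∀ v, w v = w' v) {lstar : ℕ}
    (t : Fin lstar → (v : placesOver F₀ p) → ((ofPlaces p w hw).k v)ˣ)
    (t' : Fin lstar → (v : placesOver F₀ p) → ((ofPlaces p w' hw').k v)ˣ)
    (hn : ∀ i v, ‖((t i v : ((ofPlaces p w hw).k v)ˣ) : (ofPlaces p w hw).k v)‖ =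
      ‖((t' i v : ((ofPlaces p w' hw').k v)ˣ) : (ofPlaces p w' hw').k v)‖) :
    (realPrimePacketM p (ofPlaces p w hw)).negLogThetaAt lstar t =
      (realPrimePacketM p (ofPlaces p w' hw')).negLogThetaAt lstar t' := by
  obtain rfl : w = w' := funext h
  exact realPrimePacketWith_negLogThetaAt_eq_of_norm_eq p (ofPlaces p w hw) _ _ _ t t' hn

end OfPlaces

variable {F K Fbar : Type} [Field F] [NumberField F] [Field K] [NumberField K] [Algebra F K]
  [Field Fbar] [Algebra F Fbar] [Algebra K Fbar] {E : WeierstrassCurve F} [E.IsElliptic] {l : ℕ}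
  {Pb : BadPlacePredicates K} (D : InitialThetaData F K Fbar E l Pb)
  (p : ℕ) [hp : Fact p.Prime] (u : FinitePlace ℚ) (hu : ((p : ℕ) : 𝓞 ℚ) ∈ (FinitePlace.maximalIdeal u).asIdeal)

/-- **The M-level carriers read as a local-field family over `V(F_mod)_p`**: `k v := K_{v̲} = kOfM (fibreOfPlaceOverM v)`
(unit P1's field at the member `v̲` of `V̲_u` over `v`, unit P4a's `fibreOfPlaceOverM`). By construction the summand of
P1's presentation at `v⃗' = fibreOfPlaceOverM ∘ v⃗` IS abc-iut-c312-3's `realPrimePacketM (localFieldsM …)` summand at `v⃗`.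
[cite: Mochizuki2012, IUTchI Def. 3.1 (e) p. 62] -/
def localFieldsM : LocalFields (fieldOfModuli E) p where
  k v := kOfM D p u hu (fibreOfPlaceOverM D p u hu v)

/-- `localFieldsM` is `ofPlaces` at the place map `v ↦ 𝔭_{w(v̲)}` (definitional). [folklore] -/
theorem localFieldsM_eq_ofPlaces :
    localFieldsM D p u hu = ofPlaces p (fun v => placeOfM D u (fibreOfPlaceOverM D p u hu v))
      (fun v => natCast_mem_placeOfM D p u hu (fibreOfPlaceOverM D p u hu v)) := rfl

/-- The two place maps over `V(F_mod)_p` AGREE: `liftPlace D v = 𝔭_{w(v̲)}` (unit P4a `liftPlace_placeModOfM` at the member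
over `v`, whose `placeModOfM` is `v` by `placeModOfM_fibreOfPlaceOverM`). [cite: Mochizuki2012, IUTchI Def. 3.1 (e) p. 62] -/
theorem liftPlace_eq_placeOfM_fibreOfPlaceOverM (v : placesOver (fieldOfModuli E) p) :
    ThetaData.liftPlace D v.1 = placeOfM D u (fibreOfPlaceOverM D p u hu v) := by
  rw [← liftPlace_placeModOfM D u (fibreOfPlaceOverM D p u hu v), placeModOfM_fibreOfPlaceOverM D p u hu v]

variable (r : ThetaData.IdeleData D)

/-- **The Θ-ideles at the M-level family, as units**: `t_{Θ,i+1,v} ∈ K_{v̲}^×` = unit P4a's `tThetaM` at the member over `v`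
(non-zero: `tThetaM_ne_zero`). [cite: DupuyHilado2025, §3.9] -/
def tUnitsM (i : Fin (thetaIndexOfInitial D).lstar) (v : placesOver (fieldOfModuli E) p) :
    ((localFieldsM D p u hu).k v)ˣ :=
  Units.mk0 (tThetaM D p u hu r i (fibreOfPlaceOverM D p u hu v)) (tThetaM_ne_zero D p u hu r i _)

/-- Its value is `tThetaM` at the member over `v` (definitional). [folklore] -/
theorem tUnitsM_val (i : Fin (thetaIndexOfInitial D).lstar) (v : placesOver (fieldOfModuli E) p) :
    ((tUnitsM D p u hu r i v : ((localFieldsM D p u hu).k v)ˣ) : (localFieldsM D p u hu).k v) =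
      tThetaM D p u hu r i (fibreOfPlaceOverM D p u hu v) := rfl

/-- The norms of the M-level Θ-ideles are the norms of the input's ideles (P4a `norm_tThetaM`, read at the member over `v`,
whose place over `p` is `v` again). [cite: DupuyHilado2025, §3.9] -/
theorem norm_tUnitsM (i : Fin (thetaIndexOfInitial D).lstar) (v : placesOver (fieldOfModuli E) p) :
    ‖((tUnitsM D p u hu r i v : ((localFieldsM D p u hu).k v)ˣ) : (localFieldsM D p u hu).k v)‖ =
      ‖((r.tΘ p hp.out i v : (((ThetaData.placeSection D).localFieldFamily p hp.out).k v)ˣ) :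
        ((ThetaData.placeSection D).localFieldFamily p hp.out).k v)‖ := by
  have hv : placeOverOfFibreM D p u hu (fibreOfPlaceOverM D p u hu v) = v :=
    (fibreEquivPlacesOverM D p u hu).right_inv v
  have h1 : ‖(tThetaM D p u hu r i (fibreOfPlaceOverM D p u hu v) : kOfM D p u hu (fibreOfPlaceOverM D p u hu v))‖ =
      ‖((r.tΘ p hp.out i (placeOverOfFibreM D p u hu (fibreOfPlaceOverM D p u hu v)) :
        (((ThetaData.placeSection D).localFieldFamily p hp.out).k
          (placeOverOfFibreM D p u hu (fibreOfPlaceOverM D p u hu v)))ˣ) :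
          ((ThetaData.placeSection D).localFieldFamily p hp.out).k
            (placeOverOfFibreM D p u hu (fibreOfPlaceOverM D p u hu v)))‖ :=
    norm_tThetaM D p u hu r i _
  rw [hv] at h1
  exact h1

/-! ## §2. `−|log(Θ)|_p` on the M-level carriers IS abc-iut-S2's `−|log(Θ)|_p` -/

/-- **`−|log(Θ)|_p` computed over the M-LEVEL carriers with the ideles read off `r` EQUALS abc-iut-S2's number over the
genuine completions at the section** (transport along `liftPlace D v = 𝔭_{w(v̲)}` + norm invariance).
[cite: Mochizuki2012, IUTchIII Cor. 3.12 p. 173–174] -/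
theorem negLogThetaAt_localFieldsM_eq :
    (realPrimePacketM p (localFieldsM D p u hu)).negLogThetaAt (thetaIndexOfInitial D).lstar (tUnitsM D p u hu r) =
      (realPrimePacketM p ((ThetaData.placeSection D).localFields p)).negLogThetaAt (ThetaData.pilotData D).lstar
        (r.tΘ p hp.out) := by
  exact negLogThetaAt_ofPlaces_eq p (w := fun v => placeOfM D u (fibreOfPlaceOverM D p u hu v))
    (w' := fun v => ThetaData.liftPlace D v.1) _ _
    (fun v => (liftPlace_eq_placeOfM_fibreOfPlaceOverM D p u hu v).symm) (tUnitsM D p u hu r) (r.tΘ p hp.out)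
    fun i v => norm_tUnitsM D p u hu r i v

/-- … and that number is the `p`-summand `negLogThetaLoc p` of the Θ-volume input `volumeInputOf D r`
(`ThetaVolumeInput.negLogThetaLoc_of_prime`; `packetAt p = realPrimePacketM ((placeSection D).localFieldFamily p)`).
[cite: DupuyHilado2025, Def. 3.6.3, §4.11–4.12] -/
theorem negLogThetaAt_localFieldsM_eq_negLogThetaLoc :
    (realPrimePacketM p (localFieldsM D p u hu)).negLogThetaAt (thetaIndexOfInitial D).lstar (tUnitsM D p u hu r) =
      (ThetaData.volumeInputOf D r).negLogThetaLoc p := by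
  rw [negLogThetaAt_localFieldsM_eq, ThetaVolumeInput.negLogThetaLoc_of_prime _ hp.out]
  rfl

/-! ## §3. Reindexing the setting-side orbit-hull sum along `V̲_u ≅ V(F_mod)_p` -/

/-- The Pr-weight of unit P1 at a summand `v⃗' = fibreOfPlaceOverM ∘ v⃗` is c312-3's weight `Π_a Pr(v_a)` of `v⃗`.
[cite: DupuyHilado2025, §3.6] -/
theorem weightM_fibreOfPlaceOverM_comp (j : (thetaIndexOfInitial D).Label)
    (e : (thetaIndexOfInitial D).Caps j → placesOver (fieldOfModuli E) p) :
    weightM D u j (fun a => fibreOfPlaceOverM D p u hu (e a)) = ∏ a, weight (fieldOfModuli E) (e a).1 := by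
  unfold weightM
  exact Finset.prod_congr rfl fun a _ => by rw [placeModOfM_fibreOfPlaceOverM]

/-- **The hull of the possible images of the pilot region over `localFieldsM` at a summand of degree `i+1`, in SLOT-UNION
form**: the `(R_I)^∼`-hull of the (Ind2)-orbit of `⋃_a ι_a(t_{Θ,i,v̲_a})·(R_I)^∼` with P4a's ideles (c312-3
`realPrimePacketWith_possibleImages_pilotRegion_eq`). [cite: DupuyHilado2025, §4.11–4.12] -/
theorem possibleImagesHull_pilotRegion_localFieldsM (i : Fin (thetaIndexOfInitial D).lstar)
    (e : Fin ((i : ℕ) + 1 + 1) → placesOver (fieldOfModuli E) p) :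
    (realPrimePacketM p (localFieldsM D p u hu)).possibleImagesHull
        ((realPrimePacketM p (localFieldsM D p u hu)).pilotRegion (tUnitsM D p u hu r)) ((i : ℕ) + 1) e =
      packetHull p (fun b => (localFieldsM D p u hu).k (e b))
        (⋃ g : indTwo p (fun b => (localFieldsM D p u hu).k (e b)),
          g • ⋃ a : Fin ((i : ℕ) + 1 + 1),
            iota p (fun b => (localFieldsM D p u hu).k (e b)) a
                (tThetaM D p u hu r i (fibreOfPlaceOverM D p u hu (e a))) •
              (normalizedPacket p (fun b => (localFieldsM D p u hu).k (e b)) :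
                Set (PacketAlgebra p (fun b => (localFieldsM D p u hu).k (e b))))) := by
  unfold PrimePacket.possibleImagesHull realPrimePacketM
  rw [realPrimePacketWith_possibleImages_pilotRegion_eq]
  rfl

/-- The index identification on summand indices: `(S^±_{j+1} → V̲_u) ≃ (S^±_{j+1} → V(F_mod)_p)`, componentwise P4a's
`fibreEquivPlacesOverM` (explicit lambdas, so that both directions compute by `rfl`). [cite: Mochizuki2012, IUTchI Def. 3.1 (e) p. 62] -/
def fibreArrowEquiv (n : ℕ) :
    (Fin n → (thetaIndexOfInitial D).Fibre (Val.non u)) ≃ (Fin n → placesOver (fieldOfModuli E) p) where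
  toFun e' a := placeOverOfFibreM D p u hu (e' a)
  invFun e a := fibreOfPlaceOverM D p u hu (e a)
  left_inv e' := funext fun a => (fibreEquivPlacesOverM D p u hu).left_inv (e' a)
  right_inv e := funext fun a => (fibreEquivPlacesOverM D p u hu).right_inv (e a)

/-- **One summand**: at `v⃗' = fibreOfPlaceOverM ∘ v⃗` the M-side term — Pr-weight times the normalised log-measure of the
hull of the (Ind2)-orbit of the slot union of P4a's Θ-ideles — IS c312-3's summand `log μ̄(hull of the possible images of
the pilot region)·Π_a Pr(v_a)` over `localFieldsM` at `v⃗` (carriers agree DEFINITIONALLY; weights by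
`weightM_fibreOfPlaceOverM_comp`; the region by `possibleImagesHull_pilotRegion_localFieldsM`).
[cite: DupuyHilado2025, Def. 3.6.3, §4.11–4.12] -/
theorem weightM_mul_orbitHull_fibreOf_eq (i : Fin (thetaIndexOfInitial D).lstar)
    (e : Fin ((i : ℕ) + 1 + 1) → placesOver (fieldOfModuli E) p) :
    weightM D u (Fin.succ i) (fun a => fibreOfPlaceOverM D p u hu (e a)) *
        packetLogμ p (fun b => kOfM D p u hu (fibreOfPlaceOverM D p u hu (e b)))
          (packetHull p (fun b => kOfM D p u hu (fibreOfPlaceOverM D p u hu (e b)))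
            (⋃ g : indTwo p (fun b => kOfM D p u hu (fibreOfPlaceOverM D p u hu (e b))),
              g • ⋃ a : Fin ((i : ℕ) + 1 + 1),
                iota p (fun b => kOfM D p u hu (fibreOfPlaceOverM D p u hu (e b))) a
                    (tThetaM D p u hu r i (fibreOfPlaceOverM D p u hu (e a))) •
                  (normalizedPacket p (fun b => kOfM D p u hu (fibreOfPlaceOverM D p u hu (e b))) :
                    Set (PacketAlgebra p (fun b => kOfM D p u hu (fibreOfPlaceOverM D p u hu (e b))))))) =
      (realPrimePacketM p (localFieldsM D p u hu)).logμ
          ((realPrimePacketM p (localFieldsM D p u hu)).possibleImagesHull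
            ((realPrimePacketM p (localFieldsM D p u hu)).pilotRegion (tUnitsM D p u hu r)) ((i : ℕ) + 1) e) *
        ∏ a, weight (fieldOfModuli E) (e a).1 := by
  rw [possibleImagesHull_pilotRegion_localFieldsM, weightM_fibreOfPlaceOverM_comp, mul_comm]
  rfl

/-- **REINDEXING**: the Pr-weighted sum over `v⃗' : S^±_{i+2} → V̲_u` of the normalised log-measures of the hulls of the
(Ind2)-orbits of the slot unions of P4a's Θ-ideles — the right-hand side of the setting-side hull bound (SHAPES (U1)) at
unit P1's presentation — IS c312-3's `lnνTensorPower (i+1)` of the hull of the possible images of the pilot region over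
`localFieldsM` (`Fintype.sum_equiv` along `fibreArrowEquiv`, then `weightM_mul_orbitHull_fibreOf_eq`).
[cite: DupuyHilado2025, Def. 3.6.3, §4.11–4.12] -/
theorem sum_fibre_weightM_orbitHull_eq_lnνTensorPower [Fintype ((thetaIndexOfInitial D).Fibre (Val.non u))]
    (i : Fin (thetaIndexOfInitial D).lstar) :
    (∑ e' : Fin ((i : ℕ) + 1 + 1) → (thetaIndexOfInitial D).Fibre (Val.non u),
      weightM D u (Fin.succ i) e' *
        packetLogμ p (fun b => kOfM D p u hu (e' b))
          (packetHull p (fun b => kOfM D p u hu (e' b))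
            (⋃ g : indTwo p (fun b => kOfM D p u hu (e' b)),
              g • ⋃ a : Fin ((i : ℕ) + 1 + 1),
                iota p (fun b => kOfM D p u hu (e' b)) a (tThetaM D p u hu r i (e' a)) •
                  (normalizedPacket p (fun b => kOfM D p u hu (e' b)) :
                    Set (PacketAlgebra p (fun b => kOfM D p u hu (e' b))))))) =
      (realPrimePacketM p (localFieldsM D p u hu)).lnνTensorPower ((i : ℕ) + 1)
        ((realPrimePacketM p (localFieldsM D p u hu)).possibleImagesHull
          ((realPrimePacketM p (localFieldsM D p u hu)).pilotRegion (tUnitsM D p u hu r))) := by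
  unfold PrimePacket.lnνTensorPower
  symm
  refine Fintype.sum_equiv ((fibreArrowEquiv D p u hu ((i : ℕ) + 1 + 1)).symm) _ _ fun e => ?_
  exact (weightM_mul_orbitHull_fibreOf_eq D p u hu r i e).symm

/-- **The procession average of the setting-side orbit-hull sums IS the `p`-summand of abc-iut-S2's `−|log(Θ)|`**:
`(1/ℓ⋆)·Σ_i [the sum of `sum_fibre_weightM_orbitHull_eq_lnνTensorPower`] = (volumeInputOf D r).negLogThetaLoc p` — the
GENUINE-SIDE identification of G1-Θ at the prime `p` (then §2). With abc-iut-S2's `negLogThetaNonarch = Σ_{p ∈ T(I)}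
negLogThetaLoc p` and unit (R) `negLogTheta_le_sum_add`, a setting-side bound by these sums at every `u` with `p = p_u`
yields `(M-setting).negLogTheta ≤ ↑(volumeInputOf D r).negLogTheta`. [cite: Mochizuki2012, IUTchIII Cor. 3.12 p. 173–174] -/
theorem procAvg_sum_fibre_weightM_orbitHull_eq_negLogThetaLoc [Fintype ((thetaIndexOfInitial D).Fibre (Val.non u))] :
    (1 / ((thetaIndexOfInitial D).lstar : ℝ)) * ∑ i : Fin (thetaIndexOfInitial D).lstar,
      (∑ e' : Fin ((i : ℕ) + 1 + 1) → (thetaIndexOfInitial D).Fibre (Val.non u),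
        weightM D u (Fin.succ i) e' *
          packetLogμ p (fun b => kOfM D p u hu (e' b))
            (packetHull p (fun b => kOfM D p u hu (e' b))
              (⋃ g : indTwo p (fun b => kOfM D p u hu (e' b)),
                g • ⋃ a : Fin ((i : ℕ) + 1 + 1),
                  iota p (fun b => kOfM D p u hu (e' b)) a (tThetaM D p u hu r i (e' a)) •
                    (normalizedPacket p (fun b => kOfM D p u hu (e' b)) :
                      Set (PacketAlgebra p (fun b => kOfM D p u hu (e' b))))))) =
      (ThetaData.volumeInputOf D r).negLogThetaLoc p := by
  rw [← negLogThetaAt_localFieldsM_eq_negLogThetaLoc D p u hu r]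
  unfold PrimePacket.negLogThetaAt PrimePacket.lnνLp
  congr 1
  exact Finset.sum_congr rfl fun i _ => sum_fibre_weightM_orbitHull_eq_lnνTensorPower D p u hu r i

end Summit.ABC.IUTFork.Thm311.Real

end
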